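import Summits.CriticalPhenomena.PercolationContinuityZ3.Theorems.Transplant.GrigorchukWitnessUniquenessZone
import Summits.CriticalPhenomena.PercolationContinuityZ3.Theorems.Transplant.GrigorchukGrowthUpperStretched
import HarnessLib

/-!
# Door D12, item T6b: the uniqueness zone on `Cay(𝔊 × ℤ; a,b,c,d,z)` conditional on Easo–Hutchcroft Prop. 2.1 + Lemma 2.3 AND NOTHING ELSE —
# the upper growth rate discharged by the KERNEL stretched rate of `Cay(𝔊)` («GrigorchukGrowthUpperStretched») transferred to `𝔊 × ℤ`

Proof file (`--supports stmt-CriticalPhenomena-4575`), lane `prim-bschramm`, seat `prim-bschramm-gen-1` gen 11 (GEN pen); follow-up of T6 per lead g28 #9418 /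
stmt-g41 #9422 (the `(2n+1)·|B_𝔊(n)|` ball transfer and the bridge to `GrowthUpperStretched` are typed HERE, consuming stmt-g41's kernel discharge
`stdCay_log_ballVolume_le_stretched` verbatim).  builds on p205010 (kernel theorem, internal audit signed; external expert review pending) — nothing in this
file uses p205010.  Def-free; no instance, no notation, no sorry, no `@[conjecture]`.  After this file the a-priori uniqueness zone at `p_c` on W2 — hence the
gluing input of door D12 and N2 — is conditional on the two PRINTED Easo–Hutchcroft facts ONLY; the door's remaining inputs are the PRINT lower growth exponent
`a > 1/2` and K3′ (OPEN).  NOTHING about `θ(p_c)` is asserted; `gzCay_conj4` stays OPEN.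

CONTENT (namespace `…Transplant.Grigorchuk`, §3 in `…Grigorchuk.SlabSuscept`):
* §1 `fst_step` / `fst_mem_graphBall_of_gzWalk` (the `𝔊`-coordinate along a walk of `Cay(𝔊 × ℤ)` performs a lazy walk in `Cay(𝔊)`), **`ballVolume_gzCay_le :
  |B_{Cay(𝔊×ℤ)}((g,h), n)| ≤ |B_𝔊(g, n)| · (2n+1)`** (with T2's height lemma: the ball injects into `B_𝔊(g,n) × [ht h − n, ht h + n]`).
* §2 **`growthUpperStretched_gzCay_of_stdCay`** (`log(2n+1) ≤ log 3 + n^α/α`) and **`gzCay_growthUpperStretched : ∃ α C, 0 < α ∧ α < 1 ∧ ∀ x, GrowthUpperStretched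
  gzCay x α C`** — KERNEL, from «GrigorchukGrowthUpperStretched» `stdCay_log_ballVolume_le_stretched`.
* §3 **`uniquenessZone_gzCay_of_EH (h21) (h23) (o) : UniquenessZone gzCay (p_c o)`**, `vertGluedIfJumpExp_gzCay_of_EH`, **`gzCay_jump_forces_logSlabSuscept_of_EH`**
  (N2: zone facts + growth exponent `a` + jump ⇒ `log X(L) ≥ c (log(L+2))^{a/(1−a)}`), `gzCay_jump_forces_logSlabSuscept_kernelGrowth_of_EH` (N2 with both growth
  inputs KERNEL: EH facts + jump ⇒ `log X(L) ≥ c (log(L+2))^b` for SOME `b > 0`), **`gzCay_conj4_of_EH_print`** (door of record: EH 2.1 ∧ 2.3 ∧ PRINT `a ∈ (1/2,1)` ∧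
  K3′ ⇒ Conj. 4 on W2).  Hypotheses NOT asserted.
[cite: EasoHutchcroft2023, §2.1 pp. 16–18 (Prop. 2.1, Lemma 2.3)] [cite: Grigorchuk1984, Thm. (growth bounds)] [cite: BenjaminiSchramm1996, Conj. 4; §2 (Cayley graphs)]
-/

noncomputable section

namespace Summit.CriticalPhenomena.PercolationContinuityZ3.Theorems.Transplant

namespace Grigorchuk

open SimpleGraph MeasureTheory Literature.Barriers.CriticalPhenomena Literature.Probability.Percolation SnowballSqueeze
open scoped Classical ENNReal

/-! ## §1 Balls of `Cay(𝔊 × ℤ)` against balls of `Cay(𝔊)` times height intervals -/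

/-- One letter of `𝔊 × ℤ` moves the `𝔊`-coordinate along an edge of `Cay(𝔊; a,b,c,d)` (letters `a,b,c,d`) or not at all (`z^{±1}`).
[cite: BenjaminiSchramm1996, §2 (Cayley graphs)] -/
theorem fst_step (y : L6) (g : ↥grigorchukGroup) : stdCay.Adj g (g * (L6.toP y).1) ∨ g * (L6.toP y).1 = g := by
  cases y
  · exact Or.inl (stdCay_adj_iff.2 ⟨.a, rfl⟩)
  · exact Or.inl (stdCay_adj_iff.2 ⟨.x .b, rfl⟩)
  · exact Or.inl (stdCay_adj_iff.2 ⟨.x .c, rfl⟩)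
  · exact Or.inl (stdCay_adj_iff.2 ⟨.x .d, rfl⟩)
  · exact Or.inr (by simp [L6.toP, zP])
  · exact Or.inr (by simp [L6.toP, zP])

/-- Along a walk of `Cay(𝔊 × ℤ; a,b,c,d,z)` the `𝔊`-coordinate stays in the `Cay(𝔊)`-ball of radius the length. [cite: BenjaminiSchramm1996, §2 (Cayley graphs)] -/
theorem fst_mem_graphBall_of_gzWalk {u w : GZ} (q : gzCay.Walk u w) : w.1 ∈ graphBall stdCay u.1 q.length := by
  induction q with
  | nil => exact mem_graphBall_self _ _ _
  | @cons a b c h q ih =>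
    obtain ⟨y, rfl⟩ := gzCay_adj_iff.1 h
    rw [Walk.length_cons]
    obtain ⟨p, hp⟩ := ih
    rcases fst_step y a.1 with hadj | heq
    · exact ⟨Walk.cons hadj p, by rw [Walk.length_cons]; omega⟩
    · exact ⟨p.copy heq rfl, by rw [Walk.length_copy]; omega⟩

/-- **`|B_{Cay(𝔊×ℤ)}((g,h), n)| ≤ |B_𝔊(g, n)|·(2n+1)`**: `x ↦ (x.1, ht x)` injects the ball into `B_𝔊(g, n) × [ht h − n, ht h + n]` (`fst_mem_graphBall_of_gzWalk` and
T2's height lemma `abs_toAdd_sub_le_length`). [cite: BenjaminiSchramm1996, §2 (Cayley graphs)] -/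
theorem ballVolume_gzCay_le (g : ↥grigorchukGroup) (h : Multiplicative ℤ) (n : ℕ) :
    ballVolume gzCay (g, h) n ≤ ballVolume stdCay g n * (2 * n + 1) := by
  have hIcc : (Set.Icc (Multiplicative.toAdd h - n) (Multiplicative.toAdd h + n) : Set ℤ).ncard = 2 * n + 1 := by
    rw [Set.ncard_eq_toFinset_card', Set.toFinset_Icc, Int.card_Icc]; omega
  unfold ballVolume
  rw [← hIcc, ← Set.ncard_prod]
  refine Set.ncard_le_ncard_of_injOn (fun x : GZ => (x.1, Multiplicative.toAdd x.2)) ?_ ?_ ((graphBall_finite stdCay g n).prod (Set.finite_Icc _ _))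
  · rintro x ⟨q, hq⟩
    refine Set.mk_mem_prod (graphBall_mono stdCay g hq (fst_mem_graphBall_of_gzWalk q)) ?_
    have habs : |Multiplicative.toAdd x.2 - Multiplicative.toAdd h| ≤ (q.length : ℤ) := abs_toAdd_sub_le_length q
    have hqn : (q.length : ℤ) ≤ (n : ℤ) := by exact_mod_cast hq
    obtain ⟨h1, h2⟩ := abs_le.1 (habs.trans hqn)
    simp only [Set.mem_Icc]
    constructor <;> omega
  · rintro x - x' - hxx'
    simp only [Prod.mk.injEq] at hxx'
    exact Prod.ext hxx'.1 (Multiplicative.toAdd.injective hxx'.2)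

/-! ## §2 The stretched upper rate of `Cay(𝔊 × ℤ)` — KERNEL -/

/-- **Transfer of the stretched upper rate from `Cay(𝔊)` to `Cay(𝔊 × ℤ)`**: `log |B_{𝔊×ℤ}(x, n)| ≤ log(2n+1) + log |B_𝔊(g, n)| ≤ (C + log 3 + 1/α) n^α + (C + log 3 + 1/α)`
(`log(2n+1) ≤ log 3 + log n ≤ log 3 + n^α/α`, Mathlib `Real.log_le_rpow_div`), at every vertex `x` by transitivity. [cite: Grigorchuk1984, Thm. (upper growth bound)] -/
theorem growthUpperStretched_gzCay_of_stdCay {g : ↥grigorchukGroup} {α C : ℝ} (h : GrowthUpperStretched stdCay g α C) (hα : 0 < α) (x : GZ) :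
    GrowthUpperStretched gzCay x α (C + Real.log 3 + 1 / α) := by
  refine growthUpperStretched_of_isGraphTransitive (isGraphTransitive_mulCayley _) (o := (g, 1)) (fun n => ?_) x
  have hC0 : 0 ≤ C := by
    have h1 := h 1
    have h0 : 0 ≤ Real.log (ballVolume stdCay g 1 : ℝ) := Real.log_nonneg (by exact_mod_cast one_le_ballVolume stdCay g 1)
    simp only [Nat.cast_one, Real.one_rpow, mul_one] at h1
    linarith
  have hlog3 : 0 < Real.log 3 := Real.log_pos (by norm_num)
  have hnα : 0 ≤ (n : ℝ) ^ α := Real.rpow_nonneg (Nat.cast_nonneg n) α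
  have hvol : (ballVolume gzCay (g, 1) n : ℝ) ≤ (ballVolume stdCay g n : ℝ) * (2 * n + 1) := by exact_mod_cast ballVolume_gzCay_le g 1 n
  have hB1 : (1 : ℝ) ≤ ballVolume stdCay g n := by exact_mod_cast one_le_ballVolume stdCay g n
  have hgz1 : (1 : ℝ) ≤ ballVolume gzCay (g, 1) n := by exact_mod_cast one_le_ballVolume gzCay (g, 1) n
  -- `log(2n+1) ≤ log 3 + n^α/α`
  have hlin : Real.log (2 * (n : ℝ) + 1) ≤ Real.log 3 + (n : ℝ) ^ α / α := by
    rcases Nat.eq_zero_or_pos n with rfl | hn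
    · simp only [Nat.cast_zero, mul_zero, zero_add, Real.log_one, Real.zero_rpow hα.ne', zero_div, add_zero]; exact hlog3.le
    · have hn1 : (1 : ℝ) ≤ n := by exact_mod_cast hn
      calc Real.log (2 * (n : ℝ) + 1) ≤ Real.log (3 * n) := Real.log_le_log (by linarith) (by linarith)
        _ = Real.log 3 + Real.log n := Real.log_mul (by norm_num) (by linarith)
        _ ≤ Real.log 3 + (n : ℝ) ^ α / α := by linarith [Real.log_le_rpow_div (Nat.cast_nonneg n) hα]
  calc Real.log (ballVolume gzCay (g, 1) n : ℝ) ≤ Real.log ((ballVolume stdCay g n : ℝ) * (2 * n + 1)) := Real.log_le_log (by linarith) hvol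
    _ = Real.log (ballVolume stdCay g n : ℝ) + Real.log (2 * (n : ℝ) + 1) := Real.log_mul (by linarith) (by positivity)
    _ ≤ (C * (n : ℝ) ^ α + C) + (Real.log 3 + (n : ℝ) ^ α / α) := add_le_add (h n) hlin
    _ = (C + 1 / α) * (n : ℝ) ^ α + (C + Real.log 3) := by ring
    _ ≤ (C + Real.log 3 + 1 / α) * (n : ℝ) ^ α + (C + Real.log 3 + 1 / α) := by
        nlinarith [mul_nonneg hlog3.le hnα, one_div_pos.2 hα]

/-- **The stretched upper growth rate of `Cay(𝔊 × ℤ; a,b,c,d,z)` — KERNEL**: `∃ α ∈ (0,1), ∃ C, ∀ x, log |B(x, n)| ≤ C n^α + C` for all `n`, from the kernel rate of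
`Cay(𝔊; a,b,c,d)` («GrigorchukGrowthUpperStretched» `stdCay_log_ballVolume_le_stretched`, by the concavity induction over the tree's level-one growth recursion) and
§1's transfer.  No numerical value of `α` is typed. [cite: Grigorchuk1984, Thm. (upper growth bound)] -/
theorem gzCay_growthUpperStretched : ∃ α C : ℝ, 0 < α ∧ α < 1 ∧ ∀ x : GZ, GrowthUpperStretched gzCay x α C := by
  obtain ⟨α, C, hα0, hα1, -, h⟩ := stdCay_log_ballVolume_le_stretched
  exact ⟨α, C + Real.log 3 + 1 / α, hα0, hα1, fun x => growthUpperStretched_gzCay_of_stdCay (g := 1) (fun n => h 1 n) hα0 x⟩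

namespace SlabSuscept

open LROSqueeze

/-! ## §3 The zone, N2 and door D12 on W2 — conditional on Easo–Hutchcroft Prop. 2.1 + Lemma 2.3 (and, for N2 / the door, the lower exponent and K3′) ONLY -/

/-- **The a-priori uniqueness zone at `p_c` on `Cay(𝔊 × ℤ; a,b,c,d,z)`, conditional on Easo–Hutchcroft 2023 Prop. 2.1 + Lemma 2.3 AS PRINTED and nothing else**
(the growth rate is KERNEL, `gzCay_growthUpperStretched`; connectivity, transitivity, 6-regularity and `1/6 < p_c < 1` are kernel).  A typed implication; nothing
asserted about `θ(p_c)`. [cite: EasoHutchcroft2023, §2.1 pp. 16–18 (Prop. 2.1, Lemma 2.3)] -/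
theorem uniquenessZone_gzCay_of_EH (h21 : EasoHutchcroft2023_prop_2_1) (h23 : EasoHutchcroft2023_lemma_2_3) (o : GZ) :
    UniquenessZone gzCay (criticalProbIOf gzCay o) := by
  obtain ⟨α, C, -, hα1, h⟩ := gzCay_growthUpperStretched
  exact uniquenessZone_gzCay_of_print h21 h23 (h o) hα1 o

/-- **Door D12's gluing input on W2 from the two Easo–Hutchcroft facts alone**: `∀ x, VertGluedIfJumpExp x`. [cite: EasoHutchcroft2023, §2.1 pp. 16–18] -/
theorem vertGluedIfJumpExp_gzCay_of_EH (h21 : EasoHutchcroft2023_prop_2_1) (h23 : EasoHutchcroft2023_lemma_2_3) (x : GZ) : VertGluedIfJumpExp x :=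
  vertGluedIfJumpExp_gzCay_of_uniquenessZone (uniquenessZone_gzCay_of_EH h21 h23) x

/-- **N2 on W2 with the zone's growth input discharged**: Easo–Hutchcroft Prop. 2.1 ∧ Lemma 2.3 ∧ a lower growth exponent `a ∈ (0,1)` of `Cay(𝔊)` ⇒ a jump
`θ_o(p_c) > 0` forces `log X(𝔊 × [m, m+L]) ≥ c (log(L+2))^{a/(1−a)}` for all large `L`.  Hypotheses NOT asserted. [cite: EasoHutchcroft2023, §2.1 pp. 16–18]
[cite: Hutchcroft2016, Lemma 4] [cite: Grigorchuk1984, Thm. (lower growth bound)] -/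
theorem gzCay_jump_forces_logSlabSuscept_of_EH (h21 : EasoHutchcroft2023_prop_2_1) (h23 : EasoHutchcroft2023_lemma_2_3) {a : ℝ} (ha : 0 < a) (ha1 : a < 1)
    (hG : GrowthLower stdCay (1 : ↥grigorchukGroup) a) (o : GZ) (hθ : 0 < theta gzCay o (criticalProbIOf gzCay o)) :
    ∃ c : ℝ, 0 < c ∧ ∃ L₀ : ℕ, ∀ (L : ℕ) (B : ℝ≥0∞), L₀ ≤ L → SlabSusceptLE L B →
      ENNReal.ofReal (Real.exp (c * Real.log ((L : ℝ) + 2) ^ (a / (1 - a)))) ≤ B :=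
  jump_forces_logSlabSuscept (uniquenessZone_gzCay_of_EH h21 h23) ha ha1 hG o hθ

/-- **N2 on W2 with BOTH growth inputs KERNEL — conditional on Easo–Hutchcroft Prop. 2.1 + Lemma 2.3 ONLY**: a jump `θ_o(p_c) > 0` forces
`log X(𝔊 × [m, m+L]) ≥ c (log(L+2))^b` for SOME `b > 0` and all large `L` (T5 `jump_forces_logSlabSuscept_kernelGrowth`: `b = a′/(1−a′)`, `a′ = min a ½` from 1b's kernel
lower exponent; the zone from §3).  The jump is the hypothesis under test; nothing asserted. [cite: EasoHutchcroft2023, §2.1 pp. 16–18] [cite: Hutchcroft2016, Lemma 4] -/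
theorem gzCay_jump_forces_logSlabSuscept_kernelGrowth_of_EH (h21 : EasoHutchcroft2023_prop_2_1) (h23 : EasoHutchcroft2023_lemma_2_3) (o : GZ)
    (hθ : 0 < theta gzCay o (criticalProbIOf gzCay o)) :
    ∃ b : ℝ, 0 < b ∧ ∃ c : ℝ, 0 < c ∧ ∃ L₀ : ℕ, ∀ (L : ℕ) (B : ℝ≥0∞), L₀ ≤ L → SlabSusceptLE L B →
      ENNReal.ofReal (Real.exp (c * Real.log ((L : ℝ) + 2) ^ b)) ≤ B :=
  jump_forces_logSlabSuscept_kernelGrowth (uniquenessZone_gzCay_of_EH h21 h23) o hθ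

/-- **DOOR D12 on W2, the one-input door of record with its print facts visible and the growth RATE discharged**: Easo–Hutchcroft Prop. 2.1 ∧ Lemma 2.3
(NAMED FACTS, as printed) ∧ a PRINT lower growth exponent `a ∈ (1/2, 1)` of `Cay(𝔊)` ∧ K3′ (`SlabSusceptPolySeq A`) ⇒ `gzCay_conj4`.  A typed implication: NONE of
the hypotheses is asserted; `gzCay_conj4` stays OPEN. [cite: BenjaminiSchramm1996, Conj. 4 (context: door D12)] [cite: EasoHutchcroft2023, §2.1 pp. 16–18]
[cite: Grigorchuk1984, Thm. (growth bounds)] -/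
theorem gzCay_conj4_of_EH_print (h21 : EasoHutchcroft2023_prop_2_1) (h23 : EasoHutchcroft2023_lemma_2_3) {a : ℝ} (ha : 1 / 2 < a) (ha1 : a < 1)
    (hG : GrowthLower stdCay (1 : ↥grigorchukGroup) a) {A : ℝ} (hK : SlabSusceptPolySeq A) : gzCay_conj4 :=
  doorD12_print_polySeq (uniquenessZone_gzCay_of_EH h21 h23) ha ha1 hG hK

end SlabSuscept

end Grigorchuk

end Summit.CriticalPhenomena.PercolationContinuityZ3.Theorems.Transplant
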